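import Summits.BirchSwinnertonDyer.BirchSwinnertonDyer.Theorems.PrintCf2RamifiedOffTYZCurveATwoDivisionAlgebra
import Literature.NumberTheory.EllipticCurves.TianYuanZhang2017.CMPointSevenBlockDisplays
import HarnessLib

/-!
# THE TRACE–NORM THEOREM on `A : Y² = X³ + 4X`: `(x(ΣP_j) − 2i)·∏_j (x(P_j) − 2i)` and `x(ΣP_j)·∏_j x(P_j)` are squares of elements FIXED by every
# automorphism permuting the `P_j` — the elementary form of «`cor ∘ δ = δ ∘ Tr`, `cor` = norm on `H¹(·, μ₂)`» (crux stmt-BirchSwinnertonDyer-20509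
# `RamifiedOffTYZOfFacts`, line `offtyz-v7`, LEAD g29, cycle 30, part 2b)

HONEST FRAMING (cell `bsd-print-cf2`, route `PrintCf2`; `--supports stmt-BirchSwinnertonDyer-20509`; theorems only, `def`-free, no `sorry`, standard axioms).
BSD is not proved by any of this; no class is closed by this file; item 23431 (C⁺) and crux 20509 stay OPEN.

The exact descent lemma of the memo `Lines/offtyz_v7_ExactDescent.md` §1 (proof 2), in the kernel, for TYZ's curve `A` — with NO hypothesis on the group
generated by the automorphisms (the tree bricks `TwoDescentGaloisNormProofs` / `TwoDescentCyclicTraceProofs`, p782639/p782927, needed a cyclic `2`-group and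
non-degeneracy conditions «no partial trace meets `T`» that no display discharges):

* §4 ★★★ `traceNorm_sq_fixed` (coordinate at `T⁺ = (2i,0)`) and `traceNorm_sq_fixed_zero` (coordinate at `τ(1) = (0,0)`): over a field `Ω ∋ i` of
  characteristic `0`, for affine points `P_j = (x_j, y_j)` (`j ∈ ι` finite) with HALVES `Q_j = (u_j, w_j)` (`2Q_j = P_j`, `w_j ≠ 0`) and affine sum
  `S = Σ_j P_j = (x_S, y_S)`: **there is `ρ ∈ Ω` with `(x_S − 2i)·∏_j (x_j − 2i) = ρ²` (resp. `x_S·∏_j x_j = ρ²`) and `σρ = ρ` for EVERY automorphism `σ`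
  of `Ω` with `σ i = i` permuting the `P_j`.**  Proof: `ρ = g(Q)·∏_j g(Q_j)`, `Q = Σ Q_j`, `g = g⁺` (resp. `g⁰`) the square root of `x(2·) − 2i`
  (resp. `x(2·)`) of part 2a; `Q_j^σ = Q_{πj} + R_j` with `R_j ∈ A[2]`, `Q^σ = Q + Σ R_j`, and `g(· + R) = ε(R)·g(·)` with `ε(R) = ±1` depending on `R`
  only (the sign characters of part 2a), so `σ` multiplies both factors of `ρ` by the same sign `∏_j ε(R_j)`.
(The halves exist after passing to `Ω = M̄`: part 2a §5; used in part 2c, `…GenusPeriodDescent`.)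

References: [cite: SilvermanAEC2009, Thm. X.1.1, Prop. X.1.4, III.8]; [cite: NeukirchSchmidtWingberg2008, §1.5 (corestriction = norm on H¹(·, μ₂))];
[cite: TianYuanZhang2017, §3.1 (p0011 L53–L66: Z(n) = Σ_{t∈Φ₀} z^t), Lemma 3.16]; tree: part 2a (`…CurveATwoDivisionAlgebra`), `TwoDescent`,
`TianYuanZhang2017/CMPointSevenBlockDisplays` (`galPtOver`).
-/

noncomputable section

open scoped Classical

open WeierstrassCurve WeierstrassCurve.Affine WeierstrassCurve.Affine.Point
  Literature.NumberTheory.EllipticCurves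
  Literature.NumberTheory.EllipticCurves.TianYuanZhang2017

set_option autoImplicit false

namespace Summit.BirchSwinnertonDyer.PrintCf2.GenusPeriodTraceNorm

/-! ## §4 The trace–norm theorem: `(x(S) − 2i)·∏_j (x(P_j) − 2i)` is the square of an element fixed by every automorphism permuting the `P_j` -/

section TraceNorm

variable {Ω : Type} [Field Ω] [CharZero Ω]

open Literature.NumberTheory.EllipticCurves.TianYuanZhang2017.GenusPointData (galPtOver)

/-- `(X, Y)^σ = (σX, σY)` on `A(Ω)` for any field automorphism `σ`. [cite: SilvermanAEC2009, Prop. X.1.4 (Galois bookkeeping)] -/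
theorem galPtOver_some' (σ : Ω ≃ₐ[ℚ] Ω) {x y : Ω} (h : (curveA.baseChange Ω).toAffine.Nonsingular x y) :
    ∃ h' : (curveA.baseChange Ω).toAffine.Nonsingular (σ x) (σ y), galPtOver Ω σ (Point.some x y h) = Point.some (σ x) (σ y) h' :=
  ⟨_, by rw [galPtOver, Point.map_some]; rfl⟩

/-- A point `Q` with `2Q ≠ 0` is affine with non-zero ordinate. [cite: TianYuanZhang2017, Lemma 3.16] -/
theorem exists_eq_some_of_two_smul_ne_zero {Q : APoint Ω} (hQ : (2 : ℕ) • Q ≠ 0) :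
    ∃ (u w : Ω) (h : (curveA.baseChange Ω).toAffine.Nonsingular u w), w ≠ 0 ∧ Q = Point.some u w h := by
  rcases Q with _ | ⟨u, w, h⟩
  · exact absurd (smul_zero _) hQ
  · exact ⟨u, w, h, fun hw => hQ ((two_nsmul_some_eq_zero_iff h).mpr hw), rfl⟩

/-- **THE TRACE–NORM THEOREM for the coordinate at `T⁺ = (2i, 0)`** (elementary form of «`cor ∘ δ = δ ∘ Tr`, `cor` = norm on `H¹(·, μ₂)`»).
Over a field `Ω ∋ i` of characteristic `0`: let `P_j = (x_j, y_j) ∈ A(Ω)` (`j ∈ ι` finite) with `x_j ≠ 2i`, HALVES `Q_j = (u_j, w_j)` (`2Q_j = P_j`,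
`w_j ≠ 0`) and `S := Σ_j P_j = (x_S, y_S)` affine.  Then there is `ρ ∈ Ω` with
**`(x_S − 2i)·∏_j (x_j − 2i) = ρ²`** and **`σρ = ρ` for EVERY automorphism `σ` of `Ω` fixing `i` and permuting the `P_j`**
(`P_j^σ = P_{π j}` for a permutation `π`).  Proof: `ρ = g(Q)·∏_j g(Q_j)` with `Q = Σ Q_j`, `g = (x² − 4ix + 4)/(2y)` (`x(2R) − 2i = g(R)²`);
`Q_j^σ = Q_{πj} + R_j`, `R_j ∈ A[2]`, and `g(· + R) = ε(R) g(·)` with `ε(R) = ±1` depending on `R` only, so both factors of `ρ` acquire the same sign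
`∏_j ε(R_j)`. [cite: SilvermanAEC2009, Thm. X.1.1, Prop. X.1.4] [cite: NeukirchSchmidtWingberg2008, §1.5 (cor = norm on H¹(·, μ₂))] -/
theorem traceNorm_sq_fixed {im : Ω} (him : im ^ 2 = -1) {ι : Type} [Fintype ι] [DecidableEq ι]
    (xP yP : ι → Ω) (hP : ∀ j, (curveA.baseChange Ω).toAffine.Nonsingular (xP j) (yP j))
    (xQ yQ : ι → Ω) (hQ : ∀ j, (curveA.baseChange Ω).toAffine.Nonsingular (xQ j) (yQ j)) (hyQ : ∀ j, yQ j ≠ 0)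
    (hhalf : ∀ j, (2 : ℕ) • (Point.some (xQ j) (yQ j) (hQ j) : APoint Ω) = Point.some (xP j) (yP j) (hP j))
    {xS yS : Ω} (hS : (curveA.baseChange Ω).toAffine.Nonsingular xS yS)
    (hsum : ∑ j, (Point.some (xP j) (yP j) (hP j) : APoint Ω) = Point.some xS yS hS) :
    ∃ ρ : Ω, (xS - 2 * im) * ∏ j, (xP j - 2 * im) = ρ ^ 2 ∧
      ∀ σ : Ω ≃ₐ[ℚ] Ω, σ im = im →
        (∃ π : ι ≃ ι, ∀ j, galPtOver Ω σ (Point.some (xP j) (yP j) (hP j)) = Point.some (xP (π j)) (yP (π j)) (hP (π j))) →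
        σ ρ = ρ := by
  have hi : im ≠ 0 := by intro h; rw [h] at him; norm_num at him
  -- the square-root function g⁺ and the sign character ε
  let g : APoint Ω → Ω := fun R => match R with
    | .zero => 0
    | .some x y _ => (x ^ 2 - 4 * im * x + 4) / (2 * y)
  have g_some : ∀ {x y : Ω} (h : (curveA.baseChange Ω).toAffine.Nonsingular x y),
      g (Point.some x y h) = (x ^ 2 - 4 * im * x + 4) / (2 * y) := fun _ => rfl
  let ε : APoint Ω → Ω := fun R => if R = 0 ∨ R = ptTwoI im him then 1 else -1
  have ε_sq : ∀ R, ε R ^ 2 = 1 := by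
    intro R; by_cases hR : R = 0 ∨ R = ptTwoI im him
    · simp [ε, hR]
    · simp [ε, hR]
  -- (g1) x(2Q) − 2i = g(Q)²
  have g1 : ∀ {u w X Y : Ω} (h : (curveA.baseChange Ω).toAffine.Nonsingular u w) (hw : w ≠ 0)
      (hX : (curveA.baseChange Ω).toAffine.Nonsingular X Y),
      (2 : ℕ) • (Point.some u w h : APoint Ω) = Point.some X Y hX → X - 2 * im = g (Point.some u w h) ^ 2 := by
    intro u w X Y h hw hX h2
    rw [g_some h]; exact X_two_smul_sub_twoIm him h hw hX h2
  -- (g2) σ-equivariance of g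
  have g2 : ∀ (σ : Ω ≃ₐ[ℚ] Ω), σ im = im → ∀ R : APoint Ω, σ (g R) = g (galPtOver Ω σ R) := by
    intro σ hσ R
    rcases R with _ | ⟨x, y, h⟩
    · have h0 : (galPtOver Ω σ) 0 = 0 := _root_.map_zero _
      show σ (g 0) = g ((galPtOver Ω σ) 0)
      rw [h0]; show σ 0 = 0; exact _root_.map_zero σ
    · obtain ⟨h', e⟩ := galPtOver_some' σ h
      rw [e, g_some h, g_some h']
      simp only [map_div₀, map_sub, map_add, map_pow, map_mul, hσ, map_ofNat]
  -- (g3) the sign character: g(Q + R) = ε(R) g(Q) for 2R = 0, 2Q ≠ 0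
  have g3_tau : ∀ {u w : Ω} (h : (curveA.baseChange Ω).toAffine.Nonsingular u w), w ≠ 0 →
      g (Point.some u w h + tauOne) = -g (Point.some u w h) := by
    intro u w h hw
    obtain ⟨h', e⟩ := add_tauOne_eq him h hw
    rw [e, g_some h', g_some h]; exact gPlus_add_tauOne him h hw
  have g3_plus : ∀ {u w : Ω} (h : (curveA.baseChange Ω).toAffine.Nonsingular u w), w ≠ 0 →
      g (Point.some u w h + ptTwoI im him) = g (Point.some u w h) := by
    intro u w h hw
    obtain ⟨h', e⟩ := add_ptTwoI_eq him h hw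
    rw [e, g_some h', g_some h]; exact gPlus_add_ptTwoI him h hw
  have g3 : ∀ (Q R : APoint Ω), (2 : ℕ) • Q ≠ 0 → (2 : ℕ) • R = 0 → g (Q + R) = ε R * g Q := by
    intro Q R hQ2 hR2
    obtain ⟨u, w, h, hw, rfl⟩ := exists_eq_some_of_two_smul_ne_zero hQ2
    have hu : u ≠ 0 := (A_X_ne_of_Y_ne him h hw).1
    rcases eq_of_two_nsmul_eq_zero im him hR2 with rfl | rfl | rfl | rfl
    · simp [ε]
    · have hne : ¬ ((tauOne : APoint Ω) = 0 ∨ tauOne = ptTwoI im him) := by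
        rintro (h0 | h1)
        · exact Point.some_ne_zero _ h0
        · simp only [tauOne, ptTwoI, Point.some.injEq] at h1
          exact hi (by linear_combination (-(1:Ω)/2) * h1.1)
      simp only [ε, if_neg hne]
      rw [g3_tau h hw]; ring
    · simp only [ε, if_pos (Or.inr rfl), one_mul]
      exact g3_plus h hw
    · have hne : ¬ (ptNegTwoI im him = (0 : APoint Ω) ∨ ptNegTwoI im him = ptTwoI im him) := by
        rintro (h0 | h1)
        · exact Point.some_ne_zero _ h0
        · simp only [ptNegTwoI, ptTwoI, Point.some.injEq] at h1
          exact hi (by linear_combination (-(1:Ω)/4) * h1.1)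
      simp only [ε, if_neg hne]
      -- Q + T⁻ = (Q + τ(1)) + T⁺
      rw [← tauOne_add_ptTwoI him, ← add_assoc]
      obtain ⟨h', e⟩ := add_tauOne_eq him h hw
      have hw' : -(4 * w) / u ^ 2 ≠ 0 := by
        apply div_ne_zero
        · intro h0; apply hw; linear_combination (-(1:Ω)/4) * h0
        · exact pow_ne_zero 2 hu
      rw [e, g3_plus h' hw', ← e, g3_tau h hw]; ring
  -- (g4) iterate over a sum of 2-torsion points
  have g4 : ∀ (Q : APoint Ω), (2 : ℕ) • Q ≠ 0 → ∀ (R : ι → APoint Ω), (∀ j, (2 : ℕ) • R j = 0) →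
      ∀ s : Finset ι, g (Q + ∑ j ∈ s, R j) = (∏ j ∈ s, ε (R j)) * g Q := by
    intro Q hQ2 R hR s
    induction s using Finset.induction_on with
    | empty => simp
    | insert a s ha ih =>
      rw [Finset.sum_insert ha, Finset.prod_insert ha, add_comm (R a), ← add_assoc]
      have h2 : (2 : ℕ) • (Q + ∑ j ∈ s, R j) ≠ 0 := by
        rw [smul_add, Finset.smul_sum, Finset.sum_eq_zero (fun j _ => hR j), add_zero]; exact hQ2
      rw [g3 _ _ h2 (hR a), ih]; ring
  -- the points
  set Pt : ι → APoint Ω := fun j => Point.some (xP j) (yP j) (hP j) with hPt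
  set Qt : ι → APoint Ω := fun j => Point.some (xQ j) (yQ j) (hQ j) with hQt
  have hQ2ne : ∀ j, (2 : ℕ) • Qt j ≠ 0 := fun j => by
    rw [hQt]; dsimp only; rw [hhalf j]; exact Point.some_ne_zero _
  -- Q := Σ Q_j halves S
  have hQsum : (2 : ℕ) • (∑ j, Qt j) = Point.some xS yS hS := by
    rw [Finset.smul_sum, ← hsum]
    exact Finset.sum_congr rfl fun j _ => hhalf j
  have hQne : (2 : ℕ) • (∑ j, Qt j) ≠ 0 := by rw [hQsum]; exact Point.some_ne_zero _
  obtain ⟨uQ, wQ, hQQ, hwQ, hQeq⟩ := exists_eq_some_of_two_smul_ne_zero hQne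
  -- ρ
  refine ⟨g (∑ j, Qt j) * ∏ j, g (Qt j), ?_, ?_⟩
  · -- ρ² = (x_S − 2i) ∏ (x_j − 2i)
    rw [mul_pow, ← Finset.prod_pow]
    have e1 : xS - 2 * im = g (∑ j, Qt j) ^ 2 := by
      have := g1 hQQ hwQ hS (by rw [← hQeq]; exact hQsum)
      rw [hQeq]; exact this
    rw [e1]
    congr 1
    exact Finset.prod_congr rfl fun j _ => g1 (hQ j) (hyQ j) (hP j) (hhalf j)
  · -- σρ = ρ
    intro σ hσ ⟨π, hπ⟩
    -- the 2-torsion differences R_j := Q_j^σ − Q_{π j}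
    set R : ι → APoint Ω := fun j => galPtOver Ω σ (Qt j) - Qt (π j) with hR
    have hR2 : ∀ j, (2 : ℕ) • R j = 0 := by
      intro j
      rw [hR]; dsimp only
      rw [smul_sub, ← map_nsmul, hhalf j, hπ j, sub_eq_zero, hQt]
      exact (hhalf (π j)).symm
    have hdec : ∀ j, galPtOver Ω σ (Qt j) = Qt (π j) + R j := fun j => by simp only [hR]; abel
    -- σ(∏ g Q_j) = (∏ ε R_j) ∏ g Q_j
    have hprod : σ (∏ j, g (Qt j)) = (∏ j, ε (R j)) * ∏ j, g (Qt j) := by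
      rw [map_prod]
      have : ∀ j, σ (g (Qt j)) = ε (R j) * g (Qt (π j)) := fun j => by
        refine (g2 σ hσ (Qt j)).trans ?_
        rw [hdec j, g3 _ _ (hQ2ne (π j)) (hR2 j)]
      rw [Finset.prod_congr rfl fun j _ => this j, Finset.prod_mul_distrib]
      congr 1
      exact Equiv.prod_comp π (fun j => g (Qt j))
    -- σ(g Q) = (∏ ε R_j) g Q
    have hQg : σ (g (∑ j, Qt j)) = (∏ j, ε (R j)) * g (∑ j, Qt j) := by
      refine (g2 σ hσ _).trans ?_
      rw [map_sum]
      have : ∑ j, galPtOver Ω σ (Qt j) = ∑ j, Qt j + ∑ j, R j := by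
        rw [Finset.sum_congr rfl fun j _ => hdec j, Finset.sum_add_distrib]
        congr 1
        exact Equiv.sum_comp π Qt
      rw [this]
      exact g4 _ hQne R hR2 Finset.univ
    rw [map_mul, hQg, hprod]
    have hε : (∏ j, ε (R j)) ^ 2 = 1 := by rw [← Finset.prod_pow]; simp [ε_sq]
    linear_combination (g (∑ j, Qt j) * ∏ j, g (Qt j)) * hε

/-- **THE TRACE–NORM THEOREM for the coordinate at `τ(1) = (0, 0)`** (elementary form of «`cor ∘ δ = δ ∘ Tr`, `cor` = norm on `H¹(·, μ₂)`»).
Over a field `Ω ∋ i` of characteristic `0`: let `P_j = (x_j, y_j) ∈ A(Ω)` (`j ∈ ι` finite) with `x_j ≠ 2i`, HALVES `Q_j = (u_j, w_j)` (`2Q_j = P_j`,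
`w_j ≠ 0`) and `S := Σ_j P_j = (x_S, y_S)` affine.  Then there is `ρ ∈ Ω` with
**`x_S·∏_j x_j = ρ²`** and **`σρ = ρ` for EVERY automorphism `σ` of `Ω` fixing `i` and permuting the `P_j`**
(`P_j^σ = P_{π j}` for a permutation `π`).  Proof: `ρ = g(Q)·∏_j g(Q_j)` with `Q = Σ Q_j`, `g = (x² − 4)/(2y)` (`x(2R) = g(R)²`);
`Q_j^σ = Q_{πj} + R_j`, `R_j ∈ A[2]`, and `g(· + R) = ε(R) g(·)` with `ε(R) = ±1` depending on `R` only, so both factors of `ρ` acquire the same sign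
`∏_j ε(R_j)`. [cite: SilvermanAEC2009, Thm. X.1.1, Prop. X.1.4] [cite: NeukirchSchmidtWingberg2008, §1.5 (cor = norm on H¹(·, μ₂))] -/
theorem traceNorm_sq_fixed_zero {im : Ω} (him : im ^ 2 = -1) {ι : Type} [Fintype ι] [DecidableEq ι]
    (xP yP : ι → Ω) (hP : ∀ j, (curveA.baseChange Ω).toAffine.Nonsingular (xP j) (yP j))
    (xQ yQ : ι → Ω) (hQ : ∀ j, (curveA.baseChange Ω).toAffine.Nonsingular (xQ j) (yQ j)) (hyQ : ∀ j, yQ j ≠ 0)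
    (hhalf : ∀ j, (2 : ℕ) • (Point.some (xQ j) (yQ j) (hQ j) : APoint Ω) = Point.some (xP j) (yP j) (hP j))
    {xS yS : Ω} (hS : (curveA.baseChange Ω).toAffine.Nonsingular xS yS)
    (hsum : ∑ j, (Point.some (xP j) (yP j) (hP j) : APoint Ω) = Point.some xS yS hS) :
    ∃ ρ : Ω, xS * ∏ j, xP j = ρ ^ 2 ∧
      ∀ σ : Ω ≃ₐ[ℚ] Ω, σ im = im →
        (∃ π : ι ≃ ι, ∀ j, galPtOver Ω σ (Point.some (xP j) (yP j) (hP j)) = Point.some (xP (π j)) (yP (π j)) (hP (π j))) →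
        σ ρ = ρ := by
  have hi : im ≠ 0 := by intro h; rw [h] at him; norm_num at him
  -- the square-root function g⁺ and the sign character ε
  let g : APoint Ω → Ω := fun R => match R with
    | .zero => 0
    | .some x y _ => (x ^ 2 - 4) / (2 * y)
  have g_some : ∀ {x y : Ω} (h : (curveA.baseChange Ω).toAffine.Nonsingular x y),
      g (Point.some x y h) = (x ^ 2 - 4) / (2 * y) := fun _ => rfl
  let ε : APoint Ω → Ω := fun R => if R = 0 ∨ R = tauOne then 1 else -1
  have ε_sq : ∀ R, ε R ^ 2 = 1 := by
    intro R; by_cases hR : R = 0 ∨ R = tauOne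
    · simp [ε, hR]
    · simp [ε, hR]
  -- (g1) x(2Q) − 2i = g(Q)²
  have g1 : ∀ {u w X Y : Ω} (h : (curveA.baseChange Ω).toAffine.Nonsingular u w) (hw : w ≠ 0)
      (hX : (curveA.baseChange Ω).toAffine.Nonsingular X Y),
      (2 : ℕ) • (Point.some u w h : APoint Ω) = Point.some X Y hX → X = g (Point.some u w h) ^ 2 := by
    intro u w X Y h hw hX h2
    rw [g_some h, ← sub_zero X]; exact X_two_smul_eq_sq him h hw hX h2
  -- (g2) σ-equivariance of g
  have g2 : ∀ (σ : Ω ≃ₐ[ℚ] Ω), σ im = im → ∀ R : APoint Ω, σ (g R) = g (galPtOver Ω σ R) := by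
    intro σ hσ R
    rcases R with _ | ⟨x, y, h⟩
    · have h0 : (galPtOver Ω σ) 0 = 0 := _root_.map_zero _
      show σ (g 0) = g ((galPtOver Ω σ) 0)
      rw [h0]; show σ 0 = 0; exact _root_.map_zero σ
    · obtain ⟨h', e⟩ := galPtOver_some' σ h
      rw [e, g_some h, g_some h']
      simp only [map_div₀, map_sub, map_pow, map_mul, map_ofNat]
  -- (g3) the sign character: g(Q + R) = ε(R) g(Q) for 2R = 0, 2Q ≠ 0
  have g3_tau : ∀ {u w : Ω} (h : (curveA.baseChange Ω).toAffine.Nonsingular u w), w ≠ 0 →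
      g (Point.some u w h + tauOne) = g (Point.some u w h) := by
    intro u w h hw
    obtain ⟨h', e⟩ := add_tauOne_eq him h hw
    rw [e, g_some h', g_some h]; exact gZero_add_tauOne him h hw
  have g3_plus : ∀ {u w : Ω} (h : (curveA.baseChange Ω).toAffine.Nonsingular u w), w ≠ 0 →
      g (Point.some u w h + ptTwoI im him) = -g (Point.some u w h) := by
    intro u w h hw
    obtain ⟨h', e⟩ := add_ptTwoI_eq him h hw
    rw [e, g_some h', g_some h]; exact gZero_add_ptTwoI him h hw
  have g3 : ∀ (Q R : APoint Ω), (2 : ℕ) • Q ≠ 0 → (2 : ℕ) • R = 0 → g (Q + R) = ε R * g Q := by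
    intro Q R hQ2 hR2
    obtain ⟨u, w, h, hw, rfl⟩ := exists_eq_some_of_two_smul_ne_zero hQ2
    have hu : u ≠ 0 := (A_X_ne_of_Y_ne him h hw).1
    rcases eq_of_two_nsmul_eq_zero im him hR2 with rfl | rfl | rfl | rfl
    · simp [ε]
    · simp only [ε, if_pos (Or.inr rfl), one_mul]
      exact g3_tau h hw
    · have hne : ¬ (ptTwoI im him = (0 : APoint Ω) ∨ ptTwoI im him = tauOne) := by
        rintro (h0 | h1)
        · exact Point.some_ne_zero _ h0
        · simp only [tauOne, ptTwoI, Point.some.injEq] at h1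
          exact hi (by linear_combination ((1:Ω)/2) * h1.1)
      simp only [ε, if_neg hne]
      rw [g3_plus h hw]; ring
    · have hne : ¬ (ptNegTwoI im him = (0 : APoint Ω) ∨ ptNegTwoI im him = tauOne) := by
        rintro (h0 | h1)
        · exact Point.some_ne_zero _ h0
        · simp only [ptNegTwoI, tauOne, Point.some.injEq] at h1
          exact hi (by linear_combination (-(1:Ω)/2) * h1.1)
      simp only [ε, if_neg hne]
      -- Q + T⁻ = (Q + τ(1)) + T⁺
      rw [← tauOne_add_ptTwoI him, ← add_assoc]
      obtain ⟨h', e⟩ := add_tauOne_eq him h hw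
      have hw' : -(4 * w) / u ^ 2 ≠ 0 := by
        apply div_ne_zero
        · intro h0; apply hw; linear_combination (-(1:Ω)/4) * h0
        · exact pow_ne_zero 2 hu
      rw [e, g3_plus h' hw', ← e, g3_tau h hw]; ring
  -- (g4) iterate over a sum of 2-torsion points
  have g4 : ∀ (Q : APoint Ω), (2 : ℕ) • Q ≠ 0 → ∀ (R : ι → APoint Ω), (∀ j, (2 : ℕ) • R j = 0) →
      ∀ s : Finset ι, g (Q + ∑ j ∈ s, R j) = (∏ j ∈ s, ε (R j)) * g Q := by
    intro Q hQ2 R hR s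
    induction s using Finset.induction_on with
    | empty => simp
    | insert a s ha ih =>
      rw [Finset.sum_insert ha, Finset.prod_insert ha, add_comm (R a), ← add_assoc]
      have h2 : (2 : ℕ) • (Q + ∑ j ∈ s, R j) ≠ 0 := by
        rw [smul_add, Finset.smul_sum, Finset.sum_eq_zero (fun j _ => hR j), add_zero]; exact hQ2
      rw [g3 _ _ h2 (hR a), ih]; ring
  -- the points
  set Pt : ι → APoint Ω := fun j => Point.some (xP j) (yP j) (hP j) with hPt
  set Qt : ι → APoint Ω := fun j => Point.some (xQ j) (yQ j) (hQ j) with hQt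
  have hQ2ne : ∀ j, (2 : ℕ) • Qt j ≠ 0 := fun j => by
    rw [hQt]; dsimp only; rw [hhalf j]; exact Point.some_ne_zero _
  -- Q := Σ Q_j halves S
  have hQsum : (2 : ℕ) • (∑ j, Qt j) = Point.some xS yS hS := by
    rw [Finset.smul_sum, ← hsum]
    exact Finset.sum_congr rfl fun j _ => hhalf j
  have hQne : (2 : ℕ) • (∑ j, Qt j) ≠ 0 := by rw [hQsum]; exact Point.some_ne_zero _
  obtain ⟨uQ, wQ, hQQ, hwQ, hQeq⟩ := exists_eq_some_of_two_smul_ne_zero hQne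
  -- ρ
  refine ⟨g (∑ j, Qt j) * ∏ j, g (Qt j), ?_, ?_⟩
  · -- ρ² = (x_S − 2i) ∏ (x_j − 2i)
    rw [mul_pow, ← Finset.prod_pow]
    have e1 : xS = g (∑ j, Qt j) ^ 2 := by
      have := g1 hQQ hwQ hS (by rw [← hQeq]; exact hQsum)
      rw [hQeq]; exact this
    rw [e1]
    congr 1
    exact Finset.prod_congr rfl fun j _ => g1 (hQ j) (hyQ j) (hP j) (hhalf j)
  · -- σρ = ρ
    intro σ hσ ⟨π, hπ⟩
    -- the 2-torsion differences R_j := Q_j^σ − Q_{π j}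
    set R : ι → APoint Ω := fun j => galPtOver Ω σ (Qt j) - Qt (π j) with hR
    have hR2 : ∀ j, (2 : ℕ) • R j = 0 := by
      intro j
      rw [hR]; dsimp only
      rw [smul_sub, ← map_nsmul, hhalf j, hπ j, sub_eq_zero, hQt]
      exact (hhalf (π j)).symm
    have hdec : ∀ j, galPtOver Ω σ (Qt j) = Qt (π j) + R j := fun j => by simp only [hR]; abel
    -- σ(∏ g Q_j) = (∏ ε R_j) ∏ g Q_j
    have hprod : σ (∏ j, g (Qt j)) = (∏ j, ε (R j)) * ∏ j, g (Qt j) := by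
      rw [map_prod]
      have : ∀ j, σ (g (Qt j)) = ε (R j) * g (Qt (π j)) := fun j => by
        refine (g2 σ hσ (Qt j)).trans ?_
        rw [hdec j, g3 _ _ (hQ2ne (π j)) (hR2 j)]
      rw [Finset.prod_congr rfl fun j _ => this j, Finset.prod_mul_distrib]
      congr 1
      exact Equiv.prod_comp π (fun j => g (Qt j))
    -- σ(g Q) = (∏ ε R_j) g Q
    have hQg : σ (g (∑ j, Qt j)) = (∏ j, ε (R j)) * g (∑ j, Qt j) := by
      refine (g2 σ hσ _).trans ?_
      rw [map_sum]
      have : ∑ j, galPtOver Ω σ (Qt j) = ∑ j, Qt j + ∑ j, R j := by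
        rw [Finset.sum_congr rfl fun j _ => hdec j, Finset.sum_add_distrib]
        congr 1
        exact Equiv.sum_comp π Qt
      rw [this]
      exact g4 _ hQne R hR2 Finset.univ
    rw [map_mul, hQg, hprod]
    have hε : (∏ j, ε (R j)) ^ 2 = 1 := by rw [← Finset.prod_pow]; simp [ε_sq]
    linear_combination (g (∑ j, Qt j) * ∏ j, g (Qt j)) * hε

end TraceNorm


end Summit.BirchSwinnertonDyer.PrintCf2.GenusPeriodTraceNorm

end
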